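import Mathlib.Tactic.NormNum
import Mathlib.Tactic.IntervalCases
import Mathlib.Tactic.Linarith
import Mathlib.Tactic.Positivity
import Summits.CriticalPhenomena.PercolationContinuityZ3.Theorems.PercNearOneGluingNoHeavyLowerTailAntiBandFrameBridge
import Summits.CriticalPhenomena.PercolationContinuityZ3.Theorems.PercNearOneGluingNoHeavyLowerTailAntiBandFrameC7K2TabA
import Summits.CriticalPhenomena.PercolationContinuityZ3.Theorems.PercNearOneGluingNoHeavyLowerTailAntiBandFrameC7K2TabB

/-!
# `NoHeavyLowerTail` (crux stmt-CriticalPhenomena-4575), lane prim-ineq-gen-4 (gen 28/29): (M')(7,2) and (AB_3)(7) IN THE KERNEL by a type-free frame certificate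

Support file (`--supports stmt-CriticalPhenomena-4575`; memo FINDING-FRAMES-g22 §1–§4 (frames), gen-28 memo (type-free SOS certificates)).  No definitions, no `sorry`, standard axioms.

The universal frame `w x y = [x ⊆ y]·b(#x,#y)` of FINDING-FRAMES-g22 at `(n,k) = (7,2)` (source: `top-root`) has an `S_n`-invariant Gram kernel
`G(x,x') = Σ_{y ⊇ x, y' ⊇ x'} b b C(7−1−#(y∪y'),2) = G(#x,#x',#(x∩x'))` (`frameGram`, via `AntiBandFrameSOS.sum_supersets_card_le` twice: `frameH`, `frameG`).
The exact certificate `framecert_7_2.json` writes `+G − ε_P·I` on the levels `[0, 2]` and `−G − ε_N·I` on the levels `[1]` as sums of Gram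
matrices `Σ_m c_m B_mᵀB_m`, `B_m[w,x] = g_m(#x, #(w∩x))`, `w` over the `3`-subsets (`sosP`, `sosN`; numerics in the `Num*` files), so the frame form is positive
definite on the parity class of `k` and negative definite on the other: the frame criterion (`AntiBandFrameBridge.antiBand_of_frame`, gen 22) gives
**(AB_3)(7) for all pairs of upper sets of `Finset (Fin 7)`** (`antiBand_three_of_fin_seven`), previously known only by an external exact certificate.
-/

namespace Summit.CriticalPhenomena.PercolationContinuityZ3.Theorems.AntiBandFrameC7K2

open Finset Matrix
open scoped FinsetFamily

/-! ### Certificate tables (local notation only; `framecert_7_2.json`, frame source: top-root) -/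

-- frame coefficients `b(t,j)` (`w x y = [x ⊆ y] b(#x,#y)`), zero off `t ≤ j ≤ k`
set_option quotPrecheck false in
local notation "BB7x2[" t ", " j "]" =>
  (if (t : ℕ) = 0 then (if (j : ℕ) = 0 then (1 : ℚ) else if (j : ℕ) = 1 then (((-1) : ℚ) / 3) else if (j : ℕ) = 2 then ((1 : ℚ) / 15) else (0 : ℚ)) else if (t : ℕ) = 1 then (if (j : ℕ) = 1 then (1 : ℚ) else if (j : ℕ) = 2 then (((-1) : ℚ) / 4) else (0 : ℚ)) else (if (j : ℕ) = 2 then ((1 : ℚ) / 2) else (0 : ℚ)))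
-- frame Gram `G(i,i',u)`
set_option quotPrecheck false in
local notation "GT7x2[" i ", " a ", " u "]" =>
  (if (i : ℕ) = 0 then (if (a : ℕ) = 0 then ((1 : ℚ) / 225) else if (a : ℕ) = 1 then (((-1) : ℚ) / 30) else ((1 : ℚ) / 30)) else if (i : ℕ) = 1 then (if (a : ℕ) = 0 then (((-1) : ℚ) / 30) else if (a : ℕ) = 1 then (if (u : ℕ) = 0 then (((-1) : ℚ) / 16) else (((-1) : ℚ) / 8)) else (if (u : ℕ) = 0 then ((1 : ℚ) / 4) else ((3 : ℚ) / 8))) else (if (a : ℕ) = 0 then ((1 : ℚ) / 30) else if (a : ℕ) = 1 then (if (u : ℕ) = 0 then ((1 : ℚ) / 4) else ((3 : ℚ) / 8)) else (if (u : ℕ) = 0 then ((1 : ℚ) / 4) else if (u : ℕ) = 1 then ((3 : ℚ) / 4) else ((3 : ℚ) / 2))))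
-- SOS certificate for +G - ε on levels [0, 2] (ε = 1/1024): weights, tables, tabulated kernel
set_option quotPrecheck false in
local notation "CCP7x2[" m "]" => (if (m : ℕ) = 0 then ((799 : ℚ) / 8064000) else if (m : ℕ) = 1 then ((11709603 : ℚ) / 4090880) else if (m : ℕ) = 2 then ((2815 : ℚ) / 2048) else ((85 : ℚ) / 1024))
set_option quotPrecheck false in
local notation "GGP7x2[" m ", " i ", " s "]" =>
  (if (m : ℕ) = 0 then (if (i : ℕ) = 0 then (1 : ℚ) else if (i : ℕ) = 1 then (0 : ℚ) else ((7680 : ℚ) / 799))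
      else if (m : ℕ) = 1 then (if (i : ℕ) = 0 then (0 : ℚ) else if (i : ℕ) = 1 then (0 : ℚ) else ((1 : ℚ) / 21))
      else if (m : ℕ) = 2 then (if (i : ℕ) = 0 then (0 : ℚ) else if (i : ℕ) = 1 then (0 : ℚ) else (if (s : ℕ) = 0 then (((-6) : ℚ) / 35) else if (s : ℕ) = 1 then ((1 : ℚ) / 35) else ((8 : ℚ) / 35)))
      else (if (i : ℕ) = 0 then (0 : ℚ) else if (i : ℕ) = 1 then (0 : ℚ) else (if (s : ℕ) = 0 then ((1 : ℚ) / 5) else if (s : ℕ) = 1 then (((-1) : ℚ) / 5) else ((2 : ℚ) / 5))))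
-- SOS certificate for -G - ε on levels [1] (ε = 1/64): weights, tables, tabulated kernel
set_option quotPrecheck false in
local notation "CCN7x2[" m "]" => (if (m : ℕ) = 0 then ((31 : ℚ) / 320) else ((3 : ℚ) / 640))
set_option quotPrecheck false in
local notation "GGN7x2[" m ", " i ", " s "]" =>
  (if (m : ℕ) = 0 then (if (i : ℕ) = 0 then (0 : ℚ) else if (i : ℕ) = 1 then ((1 : ℚ) / 7) else (0 : ℚ))
      else (if (i : ℕ) = 0 then (0 : ℚ) else if (i : ℕ) = 1 then (if (s : ℕ) = 0 then (((-3) : ℚ) / 7) else ((4 : ℚ) / 7)) else (0 : ℚ)))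

/-- **Frame Gram as a class function.**  For `x, x'` in the ball (`#· < 3`):
`Σ_{y,y'} w(x,y) M(y,y') w(x',y') = G(#x, #x', #(x∩x'))` with `M(y,y') = C(7−1−#(y∪y'), 2)`. [gen 28] -/
theorem frameGram (x x' : {x : Finset (Fin 7) // #x < 3}) :
    ∑ y : {x : Finset (Fin 7) // #x < 3}, ∑ y' : {x : Finset (Fin 7) // #x < 3}, (fun (x y : {x : Finset (Fin 7) // #x < 3}) => if (x : Finset (Fin 7)) ⊆ (y : Finset (Fin 7)) then (fun t j : ℕ => BB7x2[t, j]) #(x : Finset (Fin 7)) #(y : Finset (Fin 7)) else (0 : ℚ)) x y * (Matrix.of fun (x x' : {x : Finset (Fin 7) // #x < 3}) => ((7 - 1 - #((x : Finset (Fin 7)) ∪ x')).choose (3 - 1) : ℚ)) y y' * (fun (x y : {x : Finset (Fin 7) // #x < 3}) => if (x : Finset (Fin 7)) ⊆ (y : Finset (Fin 7)) then (fun t j : ℕ => BB7x2[t, j]) #(x : Finset (Fin 7)) #(y : Finset (Fin 7)) else (0 : ℚ)) x' y'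
      = GT7x2[#(x : Finset (Fin 7)), #(x' : Finset (Fin 7)), #((x : Finset (Fin 7)) ∩ x')] := by
  rw [AntiBandFrameSOS.frame_gram_subtype 7 3 (3 - 1) (by norm_num) (fun t j : ℕ => BB7x2[t, j]) x x']
  have hx : #(x : Finset (Fin 7)) ≤ (3 - 1) := by have := x.2; omega
  have hx' : #(x' : Finset (Fin 7)) ≤ (3 - 1) := by have := x'.2; omega
  rw [← frameG (x : Finset (Fin 7)) x' hx hx']
  apply Finset.sum_congr rfl
  intro y hy
  rw [mem_filter] at hy
  rw [frameH (x' : Finset (Fin 7)) y hx' hy.2.2]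

/-- SOS identity (family P), factored: `+G(x,x') = ε[x = x'] + Σ_w Σ_m c_m g_m(#x,#(w∩x)) g_m(#x',#(w∩x'))` on the subtype ball. [gen 28] -/
theorem sosP (x x' : {x : Finset (Fin 7) // #x < 3}) (hx : #(x : Finset (Fin 7)) % 2 = 0) (hx' : #(x' : Finset (Fin 7)) % 2 = 0) :
    GT7x2[#(x : Finset (Fin 7)), #(x' : Finset (Fin 7)), #((x : Finset (Fin 7)) ∩ x')]
      = (if x = x' then ((1 : ℚ) / 1024) else 0)
        + ∑ w ∈ (univ : Finset (Fin 7)).powersetCard 3, ∑ m ∈ range 4,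
            CCP7x2[m] * (GGP7x2[m, #(x : Finset (Fin 7)), #(w ∩ x)] * GGP7x2[m, #(x' : Finset (Fin 7)), #(w ∩ x')]) := by
  have hxk : #(x : Finset (Fin 7)) ≤ (3 - 1) := by have := x.2; omega
  have hxk' : #(x' : Finset (Fin 7)) ≤ (3 - 1) := by have := x'.2; omega
  have heq : (x = x') ↔ (#((x : Finset (Fin 7)) ∩ x') = #(x : Finset (Fin 7)) ∧ #(x : Finset (Fin 7)) = #(x' : Finset (Fin 7))) := by
    constructor
    · intro h; subst h; simp
    · rintro ⟨h1, h2⟩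
      apply Subtype.ext
      apply Finset.eq_of_subset_of_card_le
      · exact (AntiBandFrameSOS.subset_iff_card_inter_eq _ _).mpr h1
      · exact h2.ge
  have htab := sosP_table (x : Finset (Fin 7)) x' hx hx' hxk hxk'
  simp only [← heq] at htab
  rw [← sub_eq_iff_eq_add', htab]
  apply Finset.sum_congr rfl
  intro w _
  exact kernel_factorP _ _ _ _ hx hx' hxk hxk' (card_le_card inter_subset_right) (card_le_card inter_subset_right)

/-- SOS identity (family N), factored: `−G(x,x') = ε[x = x'] + Σ_w Σ_m c_m g_m(#x,#(w∩x)) g_m(#x',#(w∩x'))` on the subtype ball. [gen 28] -/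
theorem sosN (x x' : {x : Finset (Fin 7) // #x < 3}) (hx : #(x : Finset (Fin 7)) % 2 = 1) (hx' : #(x' : Finset (Fin 7)) % 2 = 1) :
    -GT7x2[#(x : Finset (Fin 7)), #(x' : Finset (Fin 7)), #((x : Finset (Fin 7)) ∩ x')]
      = (if x = x' then ((1 : ℚ) / 64) else 0)
        + ∑ w ∈ (univ : Finset (Fin 7)).powersetCard 3, ∑ m ∈ range 2,
            CCN7x2[m] * (GGN7x2[m, #(x : Finset (Fin 7)), #(w ∩ x)] * GGN7x2[m, #(x' : Finset (Fin 7)), #(w ∩ x')]) := by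
  have hxk : #(x : Finset (Fin 7)) ≤ (3 - 1) := by have := x.2; omega
  have hxk' : #(x' : Finset (Fin 7)) ≤ (3 - 1) := by have := x'.2; omega
  have heq : (x = x') ↔ (#((x : Finset (Fin 7)) ∩ x') = #(x : Finset (Fin 7)) ∧ #(x : Finset (Fin 7)) = #(x' : Finset (Fin 7))) := by
    constructor
    · intro h; subst h; simp
    · rintro ⟨h1, h2⟩
      apply Subtype.ext
      apply Finset.eq_of_subset_of_card_le
      · exact (AntiBandFrameSOS.subset_iff_card_inter_eq _ _).mpr h1
      · exact h2.ge
  have htab := sosN_table (x : Finset (Fin 7)) x' hx hx' hxk hxk'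
  simp only [← heq] at htab
  rw [← sub_eq_iff_eq_add', htab]
  apply Finset.sum_congr rfl
  intro w _
  exact kernel_factorN _ _ _ _ hx hx' hxk hxk' (card_le_card inter_subset_right) (card_le_card inter_subset_right)

/-- The frame form is positive definite on coefficient vectors supported on the levels `≡ 0 (mod 2)`. [gen 28] -/
theorem framePos (a : {x : Finset (Fin 7) // #x < 3} → ℚ) (ha0 : ∀ x : {x : Finset (Fin 7) // #x < 3}, ¬ (#x.1 % 2 = (3 - 1) % 2) → a x = 0) (hane : a ≠ 0) :
    0 < (fun y => ∑ x, a x * (fun (x y : {x : Finset (Fin 7) // #x < 3}) => if (x : Finset (Fin 7)) ⊆ (y : Finset (Fin 7)) then (fun t j : ℕ => BB7x2[t, j]) #(x : Finset (Fin 7)) #(y : Finset (Fin 7)) else (0 : ℚ)) x y) ⬝ᵥ ((Matrix.of fun (x x' : {x : Finset (Fin 7) // #x < 3}) => ((7 - 1 - #((x : Finset (Fin 7)) ∪ x')).choose (3 - 1) : ℚ)) *ᵥ fun y => ∑ x, a x * (fun (x y : {x : Finset (Fin 7) // #x < 3}) => if (x : Finset (Fin 7)) ⊆ (y : Finset (Fin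 7)) then (fun t j : ℕ => BB7x2[t, j]) #(x : Finset (Fin 7)) #(y : Finset (Fin 7)) else (0 : ℚ)) x y) := by
  rw [AntiBandFrameSOS.frame_qform_expand]
  have hG : (∑ x : {x : Finset (Fin 7) // #x < 3}, ∑ x' : {x : Finset (Fin 7) // #x < 3}, a x * a x' * ∑ y : {x : Finset (Fin 7) // #x < 3}, ∑ y' : {x : Finset (Fin 7) // #x < 3}, (fun (x y : {x : Finset (Fin 7) // #x < 3}) => if (x : Finset (Fin 7)) ⊆ (y : Finset (Fin 7)) then (fun t j : ℕ => BB7x2[t, j]) #(x : Finset (Fin 7)) #(y : Finset (Fin 7)) else (0 : ℚ)) x y * (Matrix.of fun (x x' : {x : Finset (Fin 7) // #x < 3}) => ((7 - 1 - #((x : Finset (Fin 7)) ∪ x')).choose (3 - 1) : ℚ)) y y' * (fun (x y : {x : Finset (Fin 7) // #x < 3}) => if (x : Finset (Fin 7)) ⊆ (y : Finset (Fin 7)) then (fun t j : ℕ => BB7x2[t, j]) #(x : Finset (Fin 7)) #(y : Finset (Fin 7)) else (0 : ℚ)) x' y')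
      = ∑ x : {x : Finset (Fin 7) // #x < 3}, ∑ x' : {x : Finset (Fin 7) // #x < 3}, a x * a x' * GT7x2[#(x : Finset (Fin 7)), #(x' : Finset (Fin 7)), #((x : Finset (Fin 7)) ∩ x')] := by
    apply Finset.sum_congr rfl; intro x _
    apply Finset.sum_congr rfl; intro x' _
    rw [frameGram x x']
  rw [hG]
  set Fm : Finset {x : Finset (Fin 7) // #x < 3} := univ.filter (fun x : {x : Finset (Fin 7) // #x < 3} => #(x : Finset (Fin 7)) % 2 = 0) with hFm
  have hzero : ∀ x : {x : Finset (Fin 7) // #x < 3}, x ∉ Fm → a x = 0 := by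
    intro x hx
    apply ha0
    intro h
    apply hx
    rw [hFm, mem_filter]
    refine ⟨mem_univ _, ?_⟩
    omega
  have h1 : ∀ x : {x : Finset (Fin 7) // #x < 3}, ∑ x' : {x : Finset (Fin 7) // #x < 3}, a x * a x' * GT7x2[#(x : Finset (Fin 7)), #(x' : Finset (Fin 7)), #((x : Finset (Fin 7)) ∩ x')] = ∑ x' ∈ Fm, a x * a x' * GT7x2[#(x : Finset (Fin 7)), #(x' : Finset (Fin 7)), #((x : Finset (Fin 7)) ∩ x')] := by
    intro x
    symm
    apply Finset.sum_subset (subset_univ Fm)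
    intro x' _ hx'
    rw [hzero x' hx']; ring
  have hrestrict : ∑ x : {x : Finset (Fin 7) // #x < 3}, ∑ x' : {x : Finset (Fin 7) // #x < 3}, a x * a x' * GT7x2[#(x : Finset (Fin 7)), #(x' : Finset (Fin 7)), #((x : Finset (Fin 7)) ∩ x')] = ∑ x ∈ Fm, ∑ x' ∈ Fm, a x * a x' * GT7x2[#(x : Finset (Fin 7)), #(x' : Finset (Fin 7)), #((x : Finset (Fin 7)) ∩ x')] := by
    rw [Finset.sum_congr rfl (fun x _ => h1 x)]
    symm
    apply Finset.sum_subset (subset_univ Fm)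
    intro x _ hx
    apply Finset.sum_eq_zero
    intro x' _
    rw [hzero x hx]; ring
  have hsos : ∑ x ∈ Fm, ∑ x' ∈ Fm, a x * a x' * (GT7x2[#(x : Finset (Fin 7)), #(x' : Finset (Fin 7)), #((x : Finset (Fin 7)) ∩ x')])
      = ∑ x ∈ Fm, ∑ x' ∈ Fm, a x * a x' * ((if x = x' then ((1 : ℚ) / 1024) else 0)
        + ∑ w ∈ (univ : Finset (Fin 7)).powersetCard 3, ∑ m ∈ range 4,
          CCP7x2[m] * (GGP7x2[m, #(x : Finset (Fin 7)), #(w ∩ x)] * GGP7x2[m, #(x' : Finset (Fin 7)), #(w ∩ x')])) := by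
    apply Finset.sum_congr rfl; intro x hx
    apply Finset.sum_congr rfl; intro x' hx'
    rw [sosP x x' (by have h := (Finset.mem_filter.mp hx).2; omega) (by have h := (Finset.mem_filter.mp hx').2; omega)]
  have hsq := AntiBandFrameSOS.sum_sum_mul_delta_add_gramsum Fm ((univ : Finset (Fin 7)).powersetCard 3) (range 4) a ((1 : ℚ) / 1024)
    (fun m => CCP7x2[m]) (fun m (x : {x : Finset (Fin 7) // #x < 3}) (w : Finset (Fin 7)) => GGP7x2[m, #(x : Finset (Fin 7)), #(w ∩ x)])
  beta_reduce at hsq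
  obtain ⟨x₀, hx₀⟩ := Function.ne_iff.mp hane
  have hx₀' : a x₀ ≠ 0 := by simpa using hx₀
  have hx₀F : x₀ ∈ Fm := by
    by_contra h
    exact hx₀' (hzero x₀ h)
  have hsq_pos : 0 < ∑ x ∈ Fm, a x ^ 2 :=
    lt_of_lt_of_le (by positivity : 0 < a x₀ ^ 2) (Finset.single_le_sum (fun x _ => sq_nonneg (a x)) hx₀F)
  have hsos_nonneg : 0 ≤ ∑ w ∈ (univ : Finset (Fin 7)).powersetCard 3, ∑ m ∈ range 4,
      CCP7x2[m] * (∑ x ∈ Fm, GGP7x2[m, #(x : Finset (Fin 7)), #(w ∩ x)] * a x) ^ 2 := by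
    apply Finset.sum_nonneg; intro w _
    apply Finset.sum_nonneg; intro m hm
    apply mul_nonneg
    · rw [Finset.mem_range] at hm
      interval_cases m <;> norm_num
    · exact sq_nonneg _
  have hε : (0 : ℚ) < ((1 : ℚ) / 1024) := by norm_num
  have hmain : 0 < ∑ x ∈ Fm, ∑ x' ∈ Fm, a x * a x' * (GT7x2[#(x : Finset (Fin 7)), #(x' : Finset (Fin 7)), #((x : Finset (Fin 7)) ∩ x')]) := by
    rw [hsos, hsq]
    exact add_pos_of_pos_of_nonneg (mul_pos hε hsq_pos) hsos_nonneg
  rw [hrestrict]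
  exact hmain

/-- The frame form is negative definite on coefficient vectors supported on the levels `≢ 0 (mod 2)`. [gen 28] -/
theorem frameNeg (a : {x : Finset (Fin 7) // #x < 3} → ℚ) (ha0 : ∀ x : {x : Finset (Fin 7) // #x < 3}, (#x.1 % 2 = (3 - 1) % 2) → a x = 0) (hane : a ≠ 0) :
    (fun y => ∑ x, a x * (fun (x y : {x : Finset (Fin 7) // #x < 3}) => if (x : Finset (Fin 7)) ⊆ (y : Finset (Fin 7)) then (fun t j : ℕ => BB7x2[t, j]) #(x : Finset (Fin 7)) #(y : Finset (Fin 7)) else (0 : ℚ)) x y) ⬝ᵥ ((Matrix.of fun (x x' : {x : Finset (Fin 7) // #x < 3}) => ((7 - 1 - #((x : Finset (Fin 7)) ∪ x')).choose (3 - 1) : ℚ)) *ᵥ fun y => ∑ x, a x * (fun (x y : {x : Finset (Fin 7) // #x < 3}) => if (x : Finset (Fin 7)) ⊆ (y : Finset (Fin 7)) then (fun t j : ℕ => BB7x2[t, j]) #(x : Finset (Fin 7)) #(y : Finset (Fin 7)) else (0 : ℚ)) x y) < 0 := by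
  rw [AntiBandFrameSOS.frame_qform_expand]
  have hG : (∑ x : {x : Finset (Fin 7) // #x < 3}, ∑ x' : {x : Finset (Fin 7) // #x < 3}, a x * a x' * ∑ y : {x : Finset (Fin 7) // #x < 3}, ∑ y' : {x : Finset (Fin 7) // #x < 3}, (fun (x y : {x : Finset (Fin 7) // #x < 3}) => if (x : Finset (Fin 7)) ⊆ (y : Finset (Fin 7)) then (fun t j : ℕ => BB7x2[t, j]) #(x : Finset (Fin 7)) #(y : Finset (Fin 7)) else (0 : ℚ)) x y * (Matrix.of fun (x x' : {x : Finset (Fin 7) // #x < 3}) => ((7 - 1 - #((x : Finset (Fin 7)) ∪ x')).choose (3 - 1) : ℚ)) y y' * (fun (x y : {x : Finset (Fin 7) // #x < 3}) => if (x : Finset (Fin 7)) ⊆ (y : Finset (Fin 7)) then (fun t j : ℕ => BB7x2[t, j]) #(x : Finset (Fin 7)) #(y : Finset (Fin 7)) else (0 : ℚ)) x' y')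
      = ∑ x : {x : Finset (Fin 7) // #x < 3}, ∑ x' : {x : Finset (Fin 7) // #x < 3}, a x * a x' * GT7x2[#(x : Finset (Fin 7)), #(x' : Finset (Fin 7)), #((x : Finset (Fin 7)) ∩ x')] := by
    apply Finset.sum_congr rfl; intro x _
    apply Finset.sum_congr rfl; intro x' _
    rw [frameGram x x']
  rw [hG]
  set Fm : Finset {x : Finset (Fin 7) // #x < 3} := univ.filter (fun x : {x : Finset (Fin 7) // #x < 3} => #(x : Finset (Fin 7)) % 2 = 1) with hFm
  have hzero : ∀ x : {x : Finset (Fin 7) // #x < 3}, x ∉ Fm → a x = 0 := by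
    intro x hx
    apply ha0
    have hn : ¬ (#(x : Finset (Fin 7)) % 2 = 1) := fun h => hx (by rw [hFm, mem_filter]; exact ⟨mem_univ _, h⟩)
    omega
  have h1 : ∀ x : {x : Finset (Fin 7) // #x < 3}, ∑ x' : {x : Finset (Fin 7) // #x < 3}, a x * a x' * GT7x2[#(x : Finset (Fin 7)), #(x' : Finset (Fin 7)), #((x : Finset (Fin 7)) ∩ x')] = ∑ x' ∈ Fm, a x * a x' * GT7x2[#(x : Finset (Fin 7)), #(x' : Finset (Fin 7)), #((x : Finset (Fin 7)) ∩ x')] := by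
    intro x
    symm
    apply Finset.sum_subset (subset_univ Fm)
    intro x' _ hx'
    rw [hzero x' hx']; ring
  have hrestrict : ∑ x : {x : Finset (Fin 7) // #x < 3}, ∑ x' : {x : Finset (Fin 7) // #x < 3}, a x * a x' * GT7x2[#(x : Finset (Fin 7)), #(x' : Finset (Fin 7)), #((x : Finset (Fin 7)) ∩ x')] = ∑ x ∈ Fm, ∑ x' ∈ Fm, a x * a x' * GT7x2[#(x : Finset (Fin 7)), #(x' : Finset (Fin 7)), #((x : Finset (Fin 7)) ∩ x')] := by
    rw [Finset.sum_congr rfl (fun x _ => h1 x)]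
    symm
    apply Finset.sum_subset (subset_univ Fm)
    intro x _ hx
    apply Finset.sum_eq_zero
    intro x' _
    rw [hzero x hx]; ring
  have hsos : ∑ x ∈ Fm, ∑ x' ∈ Fm, a x * a x' * (-GT7x2[#(x : Finset (Fin 7)), #(x' : Finset (Fin 7)), #((x : Finset (Fin 7)) ∩ x')])
      = ∑ x ∈ Fm, ∑ x' ∈ Fm, a x * a x' * ((if x = x' then ((1 : ℚ) / 64) else 0)
        + ∑ w ∈ (univ : Finset (Fin 7)).powersetCard 3, ∑ m ∈ range 2,
          CCN7x2[m] * (GGN7x2[m, #(x : Finset (Fin 7)), #(w ∩ x)] * GGN7x2[m, #(x' : Finset (Fin 7)), #(w ∩ x')])) := by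
    apply Finset.sum_congr rfl; intro x hx
    apply Finset.sum_congr rfl; intro x' hx'
    rw [sosN x x' (by have h := (Finset.mem_filter.mp hx).2; omega) (by have h := (Finset.mem_filter.mp hx').2; omega)]
  have hsq := AntiBandFrameSOS.sum_sum_mul_delta_add_gramsum Fm ((univ : Finset (Fin 7)).powersetCard 3) (range 2) a ((1 : ℚ) / 64)
    (fun m => CCN7x2[m]) (fun m (x : {x : Finset (Fin 7) // #x < 3}) (w : Finset (Fin 7)) => GGN7x2[m, #(x : Finset (Fin 7)), #(w ∩ x)])
  beta_reduce at hsq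
  obtain ⟨x₀, hx₀⟩ := Function.ne_iff.mp hane
  have hx₀' : a x₀ ≠ 0 := by simpa using hx₀
  have hx₀F : x₀ ∈ Fm := by
    by_contra h
    exact hx₀' (hzero x₀ h)
  have hsq_pos : 0 < ∑ x ∈ Fm, a x ^ 2 :=
    lt_of_lt_of_le (by positivity : 0 < a x₀ ^ 2) (Finset.single_le_sum (fun x _ => sq_nonneg (a x)) hx₀F)
  have hsos_nonneg : 0 ≤ ∑ w ∈ (univ : Finset (Fin 7)).powersetCard 3, ∑ m ∈ range 2,
      CCN7x2[m] * (∑ x ∈ Fm, GGN7x2[m, #(x : Finset (Fin 7)), #(w ∩ x)] * a x) ^ 2 := by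
    apply Finset.sum_nonneg; intro w _
    apply Finset.sum_nonneg; intro m hm
    apply mul_nonneg
    · rw [Finset.mem_range] at hm
      interval_cases m <;> norm_num
    · exact sq_nonneg _
  have hε : (0 : ℚ) < ((1 : ℚ) / 64) := by norm_num
  have hmain : 0 < ∑ x ∈ Fm, ∑ x' ∈ Fm, a x * a x' * (-GT7x2[#(x : Finset (Fin 7)), #(x' : Finset (Fin 7)), #((x : Finset (Fin 7)) ∩ x')]) := by
    rw [hsos, hsq]
    exact add_pos_of_pos_of_nonneg (mul_pos hε hsq_pos) hsos_nonneg
  rw [hrestrict]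
  have hneg := AntiBandFrameSOS.sum_sum_mul_neg Fm a (fun (x x' : {x : Finset (Fin 7) // #x < 3}) => GT7x2[#(x : Finset (Fin 7)), #(x' : Finset (Fin 7)), #((x : Finset (Fin 7)) ∩ x')])
  beta_reduce at hneg
  rw [hneg] at hmain
  exact neg_pos.mp hmain

/-- **(AB_3)(7) in the kernel.**  For all upper sets `A, B` of `Finset (Fin 7)`:
`#{s ∈ A ∩ Bᶜˢ | #s < 3 ∨ #sᶜ < 3} ≤ #{s ∈ A ∩ B | #s < 3 ∨ #sᶜ < 3}` — by the frame criterion with the type-free certificate above ((M')(7,2)). [gen 28] -/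
theorem antiBand_three_of_fin_seven (A B : Finset (Finset (Fin 7))) (hA : IsUpperSet (A : Set (Finset (Fin 7))))
    (hB : IsUpperSet (B : Set (Finset (Fin 7)))) :
    #((A ∩ Bᶜˢ).filter fun s => #s < 3 ∨ #sᶜ < 3) ≤ #((A ∩ B).filter fun s => #s < 3 ∨ #sᶜ < 3) := by
  apply AntiBandFrameBridge.antiBand_of_frame 3 (by norm_num) (by norm_num) (fun (x y : {x : Finset (Fin 7) // #x < 3}) => if (x : Finset (Fin 7)) ⊆ (y : Finset (Fin 7)) then (fun t j : ℕ => BB7x2[t, j]) #(x : Finset (Fin 7)) #(y : Finset (Fin 7)) else (0 : ℚ)) ?_ ?_ framePos frameNeg A B hA hB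
  · -- support
    intro x y h
    by_contra hle
    apply h
    beta_reduce
    rw [if_neg]
    exact fun hsub => hle hsub
  · -- diagonal
    intro x
    have hlt := x.2
    beta_reduce
    rw [if_pos (Finset.Subset.refl _)]
    generalize #(x : Finset (Fin 7)) = t at *
    interval_cases t <;> norm_num

end Summit.CriticalPhenomena.PercolationContinuityZ3.Theorems.AntiBandFrameC7K2
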